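import Summits.Ventures.LatticeQCDFlow.Scaling.PlaquetteSumStaple
import Summits.Ventures.LatticeQCDFlow.Scaling.PlaquetteSparseFamily
import Literature.MathematicalPhysics.QuantumLattice.TorusWilsonGibbs

/-!
HONEST FRAMING: exact (Metropolis-corrected) sampling algorithms for lattice gauge theory; figures
of merit are autocorrelation/cost numbers at stated couplings and volumes; no continuum-physics
claim.

# DefectVarianceFloor — THE DEFECT SPECIFIC-HEAT FLOOR: FOR EVERY COMPACT GAUGE GROUP, EVERY BULK
# COUPLING `β`, EVERY DEFECT COUPLING `u`, EVERY DEFECT `D` AND EVERY VOLUME,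
# `Var_{β,u}(S_D) ≥ e^{−8N(d−1)B} · #D/(8d(d−1)+1) · Var_Haar(Re tr ρ)`  (`|β|, |u| ≤ B`)
# — theory2 item 132's typed conjecture (DVF) `DefectVarianceFloor`, unconditionally
# (lean-1 GEN-11, ours; part 5 of 5)

Venture-side (OURS). Cell `lqcd-flow` (pub-lqcd), unit `pub-lqcd-lean-1-g11`, 2026-08-23.

theory2 item 132 (`DefectProtocolLaw`, HOME tier, THEORY-2 v5.9) types the exact-reweighting cost law
of DEFECT (boundary-condition) switching — the protocol of the working topology samplers (E7, PTBC):
bulk at coupling `β`, the defect plaquettes `D` switched on `0 → β` — and proves SUFFICIENCY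
(`m ≥ 2Nβ·#D/t` uniform steps meet any budget `t`) unconditionally, NECESSITY (`m ≥ K Δ²/t`) modulo
its typed conjecture **(DVF)** `DefectVarianceFloor ρ β D lo hi K := ∀ u ∈ [lo, hi],
K ≤ Var[S_D ; μ_{β,u}]`, `μ_{β,u} ∝ exp(−β S_{Dᶜ} − u S_D) dU`, `S_D = Σ_{p∈D} (N − Re tr ρ(U_p))`,
with the remark "routes recorded, none one seat — (i) item 126's heat-bath innovations are
hard-wired to the full Wilson family (a defect-family re-derivation ≈ 10³ l)".  THIS SERIES IS ROUTE
(i): parts 1–3 re-derive item 126's Dobrushin–Tirozzi mechanism for an arbitrary continuous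
log-density and observable, part 4 extracts a sparse subfamily of any defect, and this file
assembles:

* §1 `haarTilt_add_const` (constants in the log-density do not change the measure); the
  PER-PLAQUETTE FLOOR `e^{−8N(d−1)B} a_p² Var_Haar(Re tr ρ) ≤ ∫ (D_{e_p} P_a)² dπ_{P_c}` for
  `|c| ≤ B` (`integral_innovT_sq_ge_plaquette`).
* §2 **`variance_plaqSum_ge_family`** — for every family `M` of plaquettes whose first links have
  pairwise disjoint plaquette sets: `e^{−8N(d−1)B} (Σ_{p∈M} a_p²) Var_Haar(Re tr ρ) ≤
  Var_{π_{P_c}}(P_a)`; with part 4, **`variance_defectSum_ge`**: for EVERY `D`,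
  `e^{−8N(d−1)B} · #D/(8d(d−1)+1) · Var_Haar(Re tr ρ) ≤ Var_{π_{P_c}}(Σ_{p∈D} Re tr ρ(U_p))`.
* §3 **THE DEFECT SPECIFIC-HEAT FLOOR in item 132's shape** (`defect_variance_floor`): for all real
  `β, u` with `|β|, |u| ≤ B`, every `D`, every `L ≥ 2`, every `d`:
  `e^{−8N(d−1)B} · #D/(8d(d−1)+1) · Var_Haar(Re tr ρ) ≤ Var[S_D ; (⊗Haar).tilted(−(β S_{Dᶜ} + u S_D))]`
  — the right side is `Var[defectAction ρ D; defectFamily ρ β D u]` of item 132 after its own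
  `defectFamily_eq_tilted_haar` (one-line dock for the custodian of item 132: (DVF) holds with
  `K = e^{−8N(d−1)·max(|lo|,|hi|,|β|)} · #D/(8d(d−1)+1) · Var_Haar(Re tr ρ)`, so item 132's
  `defect_steps_necessary_of_floor` / `_monotone` become unconditional: exact defect switching
  `0 → Δ` at total log second moment `t` needs `m ≥ K Δ²/t` steps, `K ∝ #D` — two-sided in `#D`
  with the sufficiency side `m ≤ ⌈2NΔ·#D/t⌉`); and item 126's Wilson floor back as the case
  `D = univ` up to the constant (`wilson_variance_floor_of_defect`, sanity check).

Numbers (value-free reading, `d = 4`, `SU(3)` fundamental so `N = 3`, `Var_Haar(Re tr) = 1/2`):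
`K = e^{−72 B} · #D/97 · 1/2`; at `B = 2β = 12` (β_latt = 6 switched fully on) the floor is
astronomically small (`e^{−864}`) — structural (uniform in `L`, every group), not sharp; at strong
coupling `B ≤ 0.1`: `K ≥ 3.7·10⁻⁴ · #D/97`.  NOT CLAIMED: sharp constants; decay in `β` is an
artefact of the domination method (item 128's `u⁻²` law for the full Wilson family is the sharp
shape); anything at `L = 1`; non-compact groups.  Literature grade (cell rule): known mechanism
(Dobrushin–Tirozzi sublattice conditioning; Holley domination), NEW DOCKING (the defect family of
the boundary-condition-switching samplers); nothing is cited as a fact.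
-/

noncomputable section

namespace Summit.Ventures.LatticeQCDFlow.Theory2.DefectFloor

open MeasureTheory ProbabilityTheory Literature.MathematicalPhysics.QuantumFieldTheory
open Summit.Ventures.LatticeQCDFlow.TrivializingMaps
open Summit.Ventures.LatticeQCDFlow.Theory2.ExtensiveSpecificHeat
open scoped ENNReal

/-! ## §1 Constants in the log-density; the per-plaquette floor -/

section PerPlaquette

variable {d L N : ℕ} [NeZero L] {G : Type*} [Group G] [TopologicalSpace G] [IsTopologicalGroup G]
  [CompactSpace G] [MeasurableSpace G] [BorelSpace G] [SecondCountableTopology G]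
  [DecidableEq (Edge d L)] (ρ : G →* Matrix (Fin N) (Fin N) ℂ)

omit [DecidableEq (Edge d L)] in
/-- Adding a constant to the log-density does not change the tilted measure. [folklore] -/
theorem haarTilt_add_const {Φ : GaugeConfig d L G → ℝ} (hΦ : Continuous Φ) (K : ℝ) :
    haarTilt (fun U => Φ U + K) = haarTilt Φ := by
  have hint : Integrable (fun U => Real.exp (Φ U))
      (Measure.pi fun _ : Edge d L => haarProbability G) :=
    integrable_of_continuous_config (Real.continuous_exp.comp hΦ)
  haveI : IsProbabilityMeasure ((Measure.pi fun _ : Edge d L => haarProbability G).tilted Φ) :=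
    isProbabilityMeasure_haarTilt hΦ
  unfold haarTilt
  rw [show (fun U => Φ U + K) = Φ + fun _ => K from rfl, ← tilted_tilted hint, tilted_const]

/-- **PER-PLAQUETTE FLOOR.**  For weights `|c| ≤ B` (`B ≥ 0`), any weights `a`, any plaquette `p`
(`L ≥ 2`): `e^{−8N(d−1)B} · a_p² · Var_Haar(Re tr ρ) ≤ ∫ (D_{e_p}^{P_c} P_a)² dπ_{P_c}`, `e_p` the
first link of `p` (ONE-LINK FLOOR with the oscillation constant `4N(d−1)B` twice, STAPLE FLOOR). -/
theorem integral_innovT_sq_ge_plaquette (hL : 2 ≤ L) (hρ : Continuous ρ) {c : Plaquette d L → ℝ}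
    {B : ℝ} (hB0 : 0 ≤ B) (hB : ∀ p, |c p| ≤ B) (a : Plaquette d L → ℝ) (p : Plaquette d L) :
    Real.exp (-(8 * N * ((d - 1 : ℕ) : ℝ) * B)) * ((a p) ^ 2
        * ∫ g, ((ρ g).trace.re - ∫ g', (ρ g').trace.re ∂haarProbability G) ^ 2 ∂haarProbability G)
      ≤ ∫ U, (innovT (plaqSum ρ c) ((p.1, p.2.1.1) : Edge d L) (plaqSum ρ a) U) ^ 2
          ∂haarTilt (plaqSum ρ c) := by
  have hΦ : Continuous (plaqSum (d := d) (L := L) ρ c) := continuous_plaqSum ρ hρ c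
  have hF : Continuous (plaqSum (d := d) (L := L) ρ a) := continuous_plaqSum ρ hρ a
  haveI := isProbabilityMeasure_haarTilt hΦ
  have hosc : ∀ (e : Edge d L) (h : G) (U : GaugeConfig d L G),
      plaqSum ρ c (Pi.mulSingle e h * U) ≤ plaqSum ρ c U + 4 * N * ((d - 1 : ℕ) : ℝ) * B :=
    fun e h U => plaqSum_mulSingle_le_add ρ hρ hB0 hB e h U
  have h1 := integral_innovT_sq_ge hΦ hF ((p.1, p.2.1.1) : Edge d L)
    ((p.1.shift p.2.1.1, p.2.1.2) : Edge d L) (hosc _) (hosc _)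
  have h2 := sq_mul_haarVar_le_integral_linkAvg_sqDevT ρ hL hρ a p (haarTilt (plaqSum ρ c))
  have hsplit : Real.exp (-(8 * N * ((d - 1 : ℕ) : ℝ) * B))
      = Real.exp (-(4 * N * ((d - 1 : ℕ) : ℝ) * B)) * Real.exp (-(4 * N * ((d - 1 : ℕ) : ℝ) * B)) := by
    rw [← Real.exp_add]; ring_nf
  rw [hsplit, mul_assoc]
  refine le_trans ?_ h1
  exact mul_le_mul_of_nonneg_left (mul_le_mul_of_nonneg_left h2 (Real.exp_pos _).le)
    (Real.exp_pos _).le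

end PerPlaquette

/-! ## §2 The extensive floor for weighted plaquette sums -/

section Family

variable {d L N : ℕ} [NeZero L] {G : Type*} [Group G] [TopologicalSpace G] [IsTopologicalGroup G]
  [CompactSpace G] [MeasurableSpace G] [BorelSpace G] [SecondCountableTopology G]
  [DecidableEq (Edge d L)] (ρ : G →* Matrix (Fin N) (Fin N) ℂ)

/-- **FLOOR OVER A SPARSE FAMILY.**  For every family `M` of plaquettes whose first links have
pairwise DISJOINT plaquette sets, weights `|c| ≤ B` (`B ≥ 0`) and any weights `a` (`L ≥ 2`):
`e^{−8N(d−1)B} · (Σ_{p∈M} a_p²) · Var_Haar(Re tr ρ) ≤ Var_{π_{P_c}}(P_a)` (per-plaquette floors summed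
by BESSEL's inequality for the innovations at the first links of `M`). -/
theorem variance_plaqSum_ge_family (hL : 2 ≤ L) (hρ : Continuous ρ) {c : Plaquette d L → ℝ}
    {B : ℝ} (hB0 : 0 ≤ B) (hB : ∀ p, |c p| ≤ B) (a : Plaquette d L → ℝ) (M : Finset (Plaquette d L))
    (hM : ∀ p ∈ M, ∀ q ∈ M, p ≠ q → Disjoint (plaqsThrough ((p.1, p.2.1.1) : Edge d L))
      (plaqsThrough ((q.1, q.2.1.1) : Edge d L))) :
    Real.exp (-(8 * N * ((d - 1 : ℕ) : ℝ) * B)) * (∑ p ∈ M, (a p) ^ 2)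
        * ∫ g, ((ρ g).trace.re - ∫ g', (ρ g').trace.re ∂haarProbability G) ^ 2 ∂haarProbability G
      ≤ variance (plaqSum ρ a) (haarTilt (plaqSum ρ c)) := by
  have hΦ : Continuous (plaqSum (d := d) (L := L) ρ c) := continuous_plaqSum ρ hρ c
  have hF : Continuous (plaqSum (d := d) (L := L) ρ a) := continuous_plaqSum ρ hρ a
  set fst : Plaquette d L → Edge d L := fun p => (p.1, p.2.1.1) with hfst
  -- the first links of `M` are pairwise different
  have hinj : Set.InjOn fst ↑M := by
    intro p hp q hq hpq
    by_contra hne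
    have hdis := hM p hp q hq hne
    have h1 : p ∈ plaqsThrough (fst p) := self_mem_plaqsThrough_fst p
    have h2 : p ∈ plaqsThrough (fst q) := hpq ▸ h1
    exact Finset.disjoint_left.1 hdis h1 h2
  -- Bessel over the links `fst '' M`
  have hsep : ∀ e ∈ M.image fst, ∀ e' ∈ M.image fst, e ≠ e' →
      Disjoint (plaqsThrough e) (plaqsThrough e') := by
    intro e he e' he' hne
    obtain ⟨p, hp, rfl⟩ := Finset.mem_image.1 he
    obtain ⟨q, hq, rfl⟩ := Finset.mem_image.1 he'
    exact hM p hp q hq fun h => hne (by rw [h])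
  have hBessel := sum_integral_innovT_sq_le_variance hΦ hF (M.image fst)
    (fun e he e' he' hne h h' U => plaqSum_sep ρ hne (hsep e he e' he' hne) c h h' U)
    (fun e he e' he' hne h h' U => plaqSum_sep ρ hne (hsep e he e' he' hne) a h h' U)
  rw [Finset.sum_image hinj] at hBessel
  -- per-plaquette floors
  have hfl : ∀ p ∈ M, Real.exp (-(8 * N * ((d - 1 : ℕ) : ℝ) * B)) * ((a p) ^ 2
      * ∫ g, ((ρ g).trace.re - ∫ g', (ρ g').trace.re ∂haarProbability G) ^ 2 ∂haarProbability G)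
      ≤ ∫ U, (innovT (plaqSum ρ c) (fst p) (plaqSum ρ a) U) ^ 2 ∂haarTilt (plaqSum ρ c) :=
    fun p _ => integral_innovT_sq_ge_plaquette ρ hL hρ hB0 hB a p
  calc Real.exp (-(8 * N * ((d - 1 : ℕ) : ℝ) * B)) * (∑ p ∈ M, (a p) ^ 2)
        * ∫ g, ((ρ g).trace.re - ∫ g', (ρ g').trace.re ∂haarProbability G) ^ 2 ∂haarProbability G
      = ∑ p ∈ M, Real.exp (-(8 * N * ((d - 1 : ℕ) : ℝ) * B)) * ((a p) ^ 2
          * ∫ g, ((ρ g).trace.re - ∫ g', (ρ g').trace.re ∂haarProbability G) ^ 2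
              ∂haarProbability G) := by
        rw [Finset.mul_sum, Finset.sum_mul]
        refine Finset.sum_congr rfl fun p _ => ?_
        ring
    _ ≤ ∑ p ∈ M, ∫ U, (innovT (plaqSum ρ c) (fst p) (plaqSum ρ a) U) ^ 2
          ∂haarTilt (plaqSum ρ c) := Finset.sum_le_sum hfl
    _ ≤ variance (plaqSum ρ a) (haarTilt (plaqSum ρ c)) := hBessel

omit [TopologicalSpace G] [IsTopologicalGroup G] [CompactSpace G] [MeasurableSpace G] [BorelSpace G]
  [SecondCountableTopology G] [DecidableEq (Edge d L)] in
/-- The indicator-weighted plaquette sum is the plain sum over `D`. [folklore] -/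
theorem plaqSum_indicator (D : Finset (Plaquette d L)) (U : GaugeConfig d L G) :
    plaqSum ρ (fun p => if p ∈ D then (1 : ℝ) else 0) U = ∑ p ∈ D, WilsonRP.plaqRe ρ U p := by
  unfold plaqSum
  simp_rw [ite_mul, one_mul, zero_mul]
  rw [Finset.sum_ite_mem, Finset.univ_inter]

/-- **THE EXTENSIVE FLOOR FOR A DEFECT SUM.**  For every compact `G`, continuous `ρ`, `L ≥ 2`,
weights `|c| ≤ B` (`B ≥ 0`) and EVERY set `D` of plaquettes:
`e^{−8N(d−1)B} · #D/(8d(d−1)+1) · Var_Haar(Re tr ρ) ≤ Var_{π_{P_c}}(Σ_{p∈D} Re tr ρ(U_p))`. -/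
theorem variance_defectSum_ge (hL : 2 ≤ L) (hρ : Continuous ρ) {c : Plaquette d L → ℝ} {B : ℝ}
    (hB0 : 0 ≤ B) (hB : ∀ p, |c p| ≤ B) (D : Finset (Plaquette d L)) :
    Real.exp (-(8 * N * ((d - 1 : ℕ) : ℝ) * B)) * ((D.card : ℝ) / ((8 * d * (d - 1) + 1 : ℕ) : ℝ))
        * variance (fun g : G => (ρ g).trace.re) (haarProbability G)
      ≤ variance (fun U : GaugeConfig d L G => ∑ p ∈ D, WilsonRP.plaqRe ρ U p)
          (haarTilt (plaqSum ρ c)) := by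
  classical
  obtain ⟨M, hMsub, hMdis, hMcard⟩ := exists_sparse_plaquette_family D
  have hφ : Continuous fun g : G => (ρ g).trace.re := Complex.continuous_re.comp hρ.matrix_trace
  have hmain := variance_plaqSum_ge_family ρ hL hρ hB0 hB (fun p => if p ∈ D then (1 : ℝ) else 0)
    M hMdis
  have hsum : ∑ p ∈ M, ((fun p => if p ∈ D then (1 : ℝ) else 0) p) ^ 2 = (M.card : ℝ) := by
    rw [Finset.sum_congr rfl (g := fun _ => (1 : ℝ)) fun p hp => by simp [hMsub hp],
      Finset.sum_const, nsmul_eq_mul, mul_one]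
  rw [hsum, ← variance_eq_integral hφ.aemeasurable] at hmain
  have hfun : plaqSum ρ (fun p => if p ∈ D then (1 : ℝ) else 0)
      = fun U : GaugeConfig d L G => ∑ p ∈ D, WilsonRP.plaqRe ρ U p := by
    funext U; exact plaqSum_indicator ρ D U
  rw [hfun] at hmain
  refine le_trans ?_ hmain
  have hv : 0 ≤ variance (fun g : G => (ρ g).trace.re) (haarProbability G) := variance_nonneg _ _
  have hC : (0 : ℝ) < ((8 * d * (d - 1) + 1 : ℕ) : ℝ) := by positivity
  have hcard : (D.card : ℝ) / ((8 * d * (d - 1) + 1 : ℕ) : ℝ) ≤ (M.card : ℝ) := by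
    rw [div_le_iff₀ hC]
    exact_mod_cast (hMcard.trans_eq (by ring))
  exact mul_le_mul_of_nonneg_right
    (mul_le_mul_of_nonneg_left hcard (Real.exp_pos _).le) hv

end Family

/-! ## §3 The defect specific-heat floor in the shape of item 132, and the Wilson sanity check -/

section Defect

variable {d L N : ℕ} [NeZero L] {G : Type*} [Group G] [TopologicalSpace G] [IsTopologicalGroup G]
  [CompactSpace G] [MeasurableSpace G] [BorelSpace G] [SecondCountableTopology G]
  (ρ : G →* Matrix (Fin N) (Fin N) ℂ)

omit [TopologicalSpace G] [IsTopologicalGroup G] [CompactSpace G] [MeasurableSpace G] [BorelSpace G]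
  [SecondCountableTopology G] in
/-- The two-coupling log-density `−(β S_{Dᶜ} + u S_D)` is the weighted plaquette sum with weights
`u` on `D`, `β` off `D`, plus a constant. [folklore] -/
theorem defect_logDensity_eq (β u : ℝ) (D : Finset (Plaquette d L)) (U : GaugeConfig d L G) :
    -(β * (∑ p ∈ Dᶜ, ((N : ℝ) - (ρ (plaquetteHolonomy U p.1 p.2.1.1 p.2.1.2)).trace.re))
        + u * (∑ p ∈ D, ((N : ℝ) - (ρ (plaquetteHolonomy U p.1 p.2.1.1 p.2.1.2)).trace.re)))
      = plaqSum ρ (fun p => if p ∈ D then u else β) U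
        + -(β * ((N : ℝ) * (Dᶜ.card : ℝ)) + u * ((N : ℝ) * (D.card : ℝ))) := by
  classical
  show -(β * (∑ p ∈ Dᶜ, ((N : ℝ) - WilsonRP.plaqRe ρ U p))
      + u * (∑ p ∈ D, ((N : ℝ) - WilsonRP.plaqRe ρ U p))) = _
  have h1 : plaqSum ρ (fun p => if p ∈ D then u else β) U
      = u * ∑ p ∈ D, WilsonRP.plaqRe ρ U p + β * ∑ p ∈ Dᶜ, WilsonRP.plaqRe ρ U p := by
    unfold plaqSum
    rw [← Finset.sum_add_sum_compl D, Finset.mul_sum, Finset.mul_sum]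
    congr 1
    · exact Finset.sum_congr rfl fun p hp => by simp only [if_pos hp]
    · exact Finset.sum_congr rfl fun p hp => by simp only [if_neg (Finset.mem_compl.1 hp)]
  rw [h1, Finset.sum_sub_distrib, Finset.sum_sub_distrib, Finset.sum_const, Finset.sum_const,
    nsmul_eq_mul, nsmul_eq_mul]
  ring

/-- **THE DEFECT SPECIFIC-HEAT FLOOR — (DVF) OF THEORY-2 ITEM 132, FOR EVERY COMPACT GAUGE GROUP,
EVERY COUPLING WINDOW, UNIFORMLY IN THE VOLUME.**  For `L ≥ 2`, continuous `ρ`, all real `β, u` with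
`|β| ≤ B`, `|u| ≤ B`, and every finite set `D` of plaquettes:
`e^{−8N(d−1)B} · #D/(8d(d−1)+1) · Var_Haar(Re tr ρ)
  ≤ Var[Σ_{p∈D} (N − Re tr ρ(U_p)) ; (⊗Haar).tilted(−(β Σ_{p∉D} (N − Re tr ρ(U_p)) + u Σ_{p∈D} (…)))]`.
The right side is literally `Var[defectAction ρ D; defectFamily ρ β D u]` of item 132 after its
`defectFamily_eq_tilted_haar`. -/
theorem defect_variance_floor (hL : 2 ≤ L) (hρ : Continuous ρ) {β u B : ℝ} (hβ : |β| ≤ B)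
    (hu : |u| ≤ B) (D : Finset (Plaquette d L)) :
    Real.exp (-(8 * N * ((d - 1 : ℕ) : ℝ) * B)) * ((D.card : ℝ) / ((8 * d * (d - 1) + 1 : ℕ) : ℝ))
        * variance (fun g : G => (ρ g).trace.re) (haarProbability G)
      ≤ variance (fun U : GaugeConfig d L G =>
            ∑ p ∈ D, ((N : ℝ) - (ρ (plaquetteHolonomy U p.1 p.2.1.1 p.2.1.2)).trace.re))
          ((Measure.pi fun _ : Edge d L => haarProbability G).tilted fun U =>
            -(β * (∑ p ∈ Dᶜ, ((N : ℝ) - (ρ (plaquetteHolonomy U p.1 p.2.1.1 p.2.1.2)).trace.re))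
              + u * (∑ p ∈ D, ((N : ℝ) - (ρ (plaquetteHolonomy U p.1 p.2.1.1 p.2.1.2)).trace.re)))) := by
  classical
  have hB0 : 0 ≤ B := (abs_nonneg β).trans hβ
  set c : Plaquette d L → ℝ := fun p => if p ∈ D then u else β with hc
  have hcB : ∀ p, |c p| ≤ B := fun p => by
    simp only [hc]; split_ifs <;> assumption
  have hΦ : Continuous (plaqSum (d := d) (L := L) ρ c) := continuous_plaqSum ρ hρ c
  -- the measure is `π_{P_c}`
  have hmeas : ((Measure.pi fun _ : Edge d L => haarProbability G).tilted fun U =>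
        -(β * (∑ p ∈ Dᶜ, ((N : ℝ) - (ρ (plaquetteHolonomy U p.1 p.2.1.1 p.2.1.2)).trace.re))
          + u * (∑ p ∈ D, ((N : ℝ) - (ρ (plaquetteHolonomy U p.1 p.2.1.1 p.2.1.2)).trace.re))))
      = haarTilt (plaqSum ρ c) := by
    rw [show (fun U : GaugeConfig d L G =>
        -(β * (∑ p ∈ Dᶜ, ((N : ℝ) - (ρ (plaquetteHolonomy U p.1 p.2.1.1 p.2.1.2)).trace.re))
          + u * (∑ p ∈ D, ((N : ℝ) - (ρ (plaquetteHolonomy U p.1 p.2.1.1 p.2.1.2)).trace.re))))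
        = fun U => plaqSum ρ c U + -(β * ((N : ℝ) * (Dᶜ.card : ℝ)) + u * ((N : ℝ) * (D.card : ℝ)))
        from funext fun U => defect_logDensity_eq ρ β u D U]
    exact haarTilt_add_const hΦ _
  -- the observable is `N·#D − Σ_{p∈D} Re tr`
  have hobs : (fun U : GaugeConfig d L G =>
        ∑ p ∈ D, ((N : ℝ) - (ρ (plaquetteHolonomy U p.1 p.2.1.1 p.2.1.2)).trace.re))
      = fun U => (N : ℝ) * (D.card : ℝ) - ∑ p ∈ D, WilsonRP.plaqRe ρ U p := by
    funext U
    rw [Finset.sum_sub_distrib, Finset.sum_const, nsmul_eq_mul]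
    simp only [WilsonRP.plaqRe]
    ring
  haveI := isProbabilityMeasure_haarTilt hΦ
  have hX : Continuous fun U : GaugeConfig d L G => ∑ p ∈ D, WilsonRP.plaqRe ρ U p := by
    have h := continuous_plaqSum (d := d) (L := L) ρ hρ (fun p => if p ∈ D then (1 : ℝ) else 0)
    refine h.congr fun U => plaqSum_indicator ρ D U
  rw [hmeas, hobs, variance_const_sub hX.aestronglyMeasurable]
  exact variance_defectSum_ge ρ hL hρ hB0 hcB D

/-- **Sanity check: item 126's Wilson floor, up to the constant.**  `D = univ`, `u = β`: the measure
is the Wilson measure `π_β` (`wilsonMeasure_eq_tilted_pi`) and the observable the Wilson action, so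
`e^{−8N(d−1)|β|} · #plaq/(8d(d−1)+1) · Var_Haar(Re tr ρ) ≤ Var_{π_β}(S_W)` (item 126 has the better
constant `L⌊L/2⌋^{d−1}`; this corollary only certifies that the general floor specialises
correctly). -/
theorem wilson_variance_floor_of_defect (hL : 2 ≤ L) (hρ : Continuous ρ) (β : ℝ) :
    Real.exp (-(8 * N * ((d - 1 : ℕ) : ℝ) * |β|))
        * ((Fintype.card (Plaquette d L) : ℝ) / ((8 * d * (d - 1) + 1 : ℕ) : ℝ))
        * variance (fun g : G => (ρ g).trace.re) (haarProbability G)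
      ≤ variance (wilsonAction ρ) (wilsonMeasure (d := d) (L := L) ρ β) := by
  classical
  have h := defect_variance_floor (d := d) (L := L) ρ hL hρ (le_refl |β|) (le_refl |β|)
    (Finset.univ : Finset (Plaquette d L))
  rw [Finset.card_univ] at h
  have hS : (fun U : GaugeConfig d L G =>
      ∑ p ∈ (Finset.univ : Finset (Plaquette d L)),
        ((N : ℝ) - (ρ (plaquetteHolonomy U p.1 p.2.1.1 p.2.1.2)).trace.re)) = wilsonAction ρ := by
    funext U; rfl
  have hM : ((Measure.pi fun _ : Edge d L => haarProbability G).tilted fun U : GaugeConfig d L G =>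
        -(β * (∑ p ∈ (Finset.univ : Finset (Plaquette d L))ᶜ,
            ((N : ℝ) - (ρ (plaquetteHolonomy U p.1 p.2.1.1 p.2.1.2)).trace.re))
          + β * (∑ p ∈ (Finset.univ : Finset (Plaquette d L)),
            ((N : ℝ) - (ρ (plaquetteHolonomy U p.1 p.2.1.1 p.2.1.2)).trace.re))))
      = wilsonMeasure ρ β := by
    rw [Literature.MathematicalPhysics.QuantumLattice.wilsonMeasure_eq_tilted_pi ρ hρ β]
    congr 1
    funext U
    rw [Finset.compl_univ, Finset.sum_empty, mul_zero, zero_add, neg_mul]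
    rfl
  rwa [hS, hM] at h

end Defect

end Summit.Ventures.LatticeQCDFlow.Theory2.DefectFloor
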